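import Mathlib
import HarnessLib
import Summits.MatrixMultiplication.MatrixMultiplication.Theorems.OutsiderSandwichToricCeilingPowMixedGlue
import Summits.MatrixMultiplication.MatrixMultiplication.Theorems.OutsiderSandwichToricCeilingPowSubTwoSpread

/-!
# OutsiderSandwich — mixed-basis toric ceiling `⟨3^N - 2⟩`, part 3: the two-basis letter law and
the local rules of the CROSSED / SPREAD / PURE slices at a cw tail coordinate
(decomp-mm lens 4, gen 46, kernel K46-3; THESES-FREE, `ω`-free; helper toward `LaserTangency`,
stmt-32268 — the extremal subrank/packing cells of the literal host `kroneckerPow (cwTensor ℂ 2) N`)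

LABEL.  TORIC · uniform in `N` · NEC-side instrument; infrastructure for the mixed-basis analogue
of `…PowSubTwo` (product bases `κ` with ONE Coppersmith–Winograd coordinate, `N ≥ 3`); the rates,
the crux `h₁ = LaserTangency` and the route's `closes` are untouched.

WHAT.  The six missing words `x₁, x₂ | y₁, y₂ | z₁, z₂` of a leg-injective `Ψ ⊆ frame κ` with
`#Ψ = 3^N - 2` obey, at a coordinate `i`, the law `lawκ (κ i)`: at a permutation coordinate every
letter occurs exactly TWICE (`…PowSubTwoRules.twice`), at a cw coordinate the letter `0` occurs
twice and the letters `1`, `2` an odd number of times (`cwLaw`; both from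
`…ToricComplement.two_missing_letters_dcoord/cwcoord`, see `lawκ_of_counts`).  The slice
constructions of `…PowSubTwo` (pivot at a PERMUTATION coordinate `p`, primary direction `d`,
auxiliary triples of direction `2d`) need, at every TAIL coordinate `j`, letters for the auxiliary
rows subject to local constraints that depend on the basis flag `κ j`:
* rows in the slot pattern `slotB (κ j)` (a permutation, resp. a cw pattern `{0, ι, ι}`),
* star slots with pairwise distinct letters (matched one level down by `…PowMixedStar.hasPM_star`),
* co-size-2 slots obeying `lawκ (κ j)` (matched one level down by induction),
* at permutation coordinates only: the letterwise FLAGS that make the constructed missing pairs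
  distinct words (a cw coordinate cannot always supply them; censuses NODE-g46 §3).
At a permutation coordinate the rules are those of `…PowSubTwoRules` / `…PowSubTwoSpread`
(`crAux`, `spRule r`) and, for the NEW PURE SLICE (three co-size-2 slots and four auxiliary
triples, replacing the parallel-class layers of the tight case, which have no cw analogue), the
candidate list `puDList` (part 3b, `…PowMixedRulesPure`); at a cw coordinate they are FIRST-FIT
CHOICES from short candidate lists (`crCwList` 9, `spCwList` 6 here; `puCwList` / `puCwList₂`
18 + 18 in part 3b) found by a greedy cover (cell folder `exp/cover.py`) and CERTIFIED by `decide`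
over `Bool × Fin 3⁶`: `crκ_spec`, `spκ_spec` (every lawful configuration is served; part 3b:
`puκ_spec`, `puκ_diff`).  All definitions are plain data (`Bool` / letter-valued).

NOTE (a cw subtlety, NODE-g46 §3).  Under `cwLaw` two doubled pairs do NOT force the third pair to
be doubled (`0 0 | 1 1 | 1 2` is lawful), unlike `twice`; the pivot of every slice is therefore
taken at a PERMUTATION coordinate, where `…PowSubTwoRules.pure_letters / crossed_letters /
spread_letters` classify the configuration.
-/

set_option linter.dupNamespace false

namespace Summit.MatrixMultiplication.MatrixMultiplication.Theorems.OutsiderSandwichToricCeilingPowMixedRules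

open Finset
open Summit.MatrixMultiplication.MatrixMultiplication.Theorems.OutsiderSandwichToricCeiling (cwSlot dSlot)
open Summit.MatrixMultiplication.MatrixMultiplication.Theorems.OutsiderSandwichToricCeilingPowFibres
  (Word Tr3 slotB frame)
open Summit.MatrixMultiplication.MatrixMultiplication.Theorems.OutsiderSandwichToricCeilingPowSubTwoGlue
open Summit.MatrixMultiplication.MatrixMultiplication.Theorems.OutsiderSandwichToricCeilingPowSubTwoRules
open Summit.MatrixMultiplication.MatrixMultiplication.Theorems.OutsiderSandwichToricCeilingPowSubTwoSpread
open Summit.MatrixMultiplication.MatrixMultiplication.Theorems.OutsiderSandwichToricCeilingPowMixedGlue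

set_option synthInstance.maxHeartbeats 400000
set_option synthInstance.maxSize 4096

/-! ## §1 The two-basis letter law -/

/-- Number of occurrences of the letter `α` among six letters, in the bracketing of
`…ToricComplement.two_missing_letters_dcoord/cwcoord`. [new] -/
def cnt (α a b c d e f : Fin 3) : ℕ :=
  (if a = α then 1 else 0) + (if b = α then 1 else 0) + ((if c = α then 1 else 0) +
    (if d = α then 1 else 0)) + ((if e = α then 1 else 0) + (if f = α then 1 else 0))

/-- THE CW LETTER LAW of six missing letters at a Coppersmith–Winograd coordinate: `0` twice,
`1` and `2` an odd number of times (Boolean). [new] -/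
def cwLaw (a b c d e f : Fin 3) : Bool :=
  decide (cnt 0 a b c d e f = 2 ∧ cnt 1 a b c d e f % 2 = 1 ∧ cnt 2 a b c d e f % 2 = 1)

/-- THE TWO-BASIS LETTER LAW: `twice` at a permutation coordinate (`q = false`), `cwLaw` at a cw
coordinate (`q = true`). [new] -/
def lawκ (q : Bool) (a b c d e f : Fin 3) : Bool :=
  if q then cwLaw a b c d e f else twice a b c d e f

/-- At a permutation coordinate the law is `twice` (definitionally). -/
theorem lawκ_false (a b c d e f : Fin 3) : lawκ false a b c d e f = twice a b c d e f := rfl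

/-- At a cw coordinate the law is `cwLaw` (definitionally). -/
theorem lawκ_true (a b c d e f : Fin 3) : lawκ true a b c d e f = cwLaw a b c d e f := rfl

/-- The law from the letter counts of `…ToricComplement.two_missing_letters_dcoord/cwcoord`
(permutation coordinate: every count is `2`; cw coordinate: count of `0` is `2`, counts of `1`, `2`
odd). -/
theorem lawκ_of_counts (q : Bool) (a b c d e f : Fin 3)
    (hD : q = false → ∀ α, cnt α a b c d e f = 2)
    (hC : q = true → cnt 0 a b c d e f = 2 ∧ Odd (cnt 1 a b c d e f) ∧ Odd (cnt 2 a b c d e f)) :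
    lawκ q a b c d e f = true := by
  cases q
  · rw [lawκ_false, twice_iff]
    exact hD rfl
  · obtain ⟨h0, h1, h2⟩ := hC rfl
    rw [lawκ_true, cwLaw, decide_eq_true_iff]
    exact ⟨h0, Nat.odd_iff.1 h1, Nat.odd_iff.1 h2⟩

/-- `lawκ` is invariant under swapping the two `x`-letters. -/
theorem lawκ_swap_x : ∀ (q : Bool) (a b c d e f : Fin 3), lawκ q a b c d e f = true →
    lawκ q b a c d e f = true := by
  decide

/-- `lawκ` is invariant under swapping the two `y`-letters. -/
theorem lawκ_swap_y : ∀ (q : Bool) (a b c d e f : Fin 3), lawκ q a b c d e f = true →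
    lawκ q a b d c e f = true := by
  decide

/-- `lawκ` is invariant under swapping the two `z`-letters. -/
theorem lawκ_swap_z : ∀ (q : Bool) (a b c d e f : Fin 3), lawκ q a b c d e f = true →
    lawκ q a b c d f e = true := by
  decide

/-- `lawκ` is invariant under rotating the three pairs. -/
theorem lawκ_rot : ∀ (q : Bool) (a b c d e f : Fin 3), lawκ q a b c d e f = true →
    lawκ q c d e f a b = true := by
  decide

/-! ## §2 First-fit choice from a candidate list -/

/-- The first entry of `L` satisfying `good`, or the default `d₀`. [new] -/
def pick {α : Type} (L : List α) (good : α → Bool) (d₀ : α) : α :=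
  match L.find? good with
  | some c => c
  | none => d₀

/-! ## §3 The CROSSED rule in both bases -/

/-- CROSSED candidate rows at a cw tail coordinate (9 pairs of cw rows, found by a greedy cover of
the 120 cw letter configurations). [new] -/
def crCwList : List ((Fin 3 × Fin 3 × Fin 3) × (Fin 3 × Fin 3 × Fin 3)) :=
  [((0, 1, 1), (2, 2, 0)),
   ((0, 2, 2), (1, 1, 0)),
   ((1, 0, 1), (0, 2, 2)),
   ((1, 1, 0), (2, 2, 0)),
   ((0, 1, 1), (0, 1, 1)),
   ((0, 1, 1), (0, 2, 2)),
   ((0, 2, 2), (0, 1, 1)),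
   ((0, 2, 2), (0, 2, 2)),
   ((1, 0, 1), (2, 2, 0))]

/-- The CROSSED local constraints ON A CANDIDATE pair of auxiliary rows `((A₁,B₁,C₁),(A₂,B₂,C₂))`
at a tail coordinate with basis flag `q` and missing letters `x₁ x₂ | y_b y_c | z_b z_c`: rows in
the slot pattern, the two star slots `(A₂, y_c, C₁)`, `(A₁, B₂, z_b)` letter-distinct, the co-size-2
slot `(x₁ x₂ | y_b B₁ | z_c C₂)` lawful, and — at a permutation coordinate only — the flags
`B₁ ≠ y_b`, `C₂ ≠ z_c`. [new] -/
def crGoodAt (q : Bool) (x₁ x₂ yb yc zb zc : Fin 3)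
    (c : (Fin 3 × Fin 3 × Fin 3) × (Fin 3 × Fin 3 × Fin 3)) : Bool :=
  decide (slotB q c.1.1 c.1.2.1 c.1.2.2 = true ∧ slotB q c.2.1 c.2.2.1 c.2.2.2 = true ∧
    (c.2.1 ≠ yc ∧ yc ≠ c.1.2.2 ∧ c.2.1 ≠ c.1.2.2) ∧ (c.1.1 ≠ c.2.2.1 ∧ c.2.2.1 ≠ zb ∧ c.1.1 ≠ zb) ∧
    lawκ q x₁ x₂ yb c.1.2.1 zc c.2.2.2 = true ∧ (q = false → c.1.2.1 ≠ yb ∧ c.2.2.2 ≠ zc))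

/-- THE CROSSED RULE IN BOTH BASES: the flip rule `crAux` of `…PowSubTwoRules` at a permutation
coordinate, the first fitting entry of `crCwList` at a cw coordinate. [new] -/
def crκ (q : Bool) (x₁ x₂ yb yc zb zc : Fin 3) :
    (Fin 3 × Fin 3 × Fin 3) × (Fin 3 × Fin 3 × Fin 3) :=
  if q then pick crCwList (crGoodAt true x₁ x₂ yb yc zb zc) ((0, 1, 1), (0, 1, 1))
  else crAux yb yc zb zc

/-- [new] -/ def crκA₁ (q : Bool) (x₁ x₂ yb yc zb zc : Fin 3) : Fin 3 :=
  (crκ q x₁ x₂ yb yc zb zc).1.1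
/-- [new] -/ def crκB₁ (q : Bool) (x₁ x₂ yb yc zb zc : Fin 3) : Fin 3 :=
  (crκ q x₁ x₂ yb yc zb zc).1.2.1
/-- [new] -/ def crκC₁ (q : Bool) (x₁ x₂ yb yc zb zc : Fin 3) : Fin 3 :=
  (crκ q x₁ x₂ yb yc zb zc).1.2.2
/-- [new] -/ def crκA₂ (q : Bool) (x₁ x₂ yb yc zb zc : Fin 3) : Fin 3 :=
  (crκ q x₁ x₂ yb yc zb zc).2.1
/-- [new] -/ def crκB₂ (q : Bool) (x₁ x₂ yb yc zb zc : Fin 3) : Fin 3 :=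
  (crκ q x₁ x₂ yb yc zb zc).2.2.1
/-- [new] -/ def crκC₂ (q : Bool) (x₁ x₂ yb yc zb zc : Fin 3) : Fin 3 :=
  (crκ q x₁ x₂ yb yc zb zc).2.2.2

/-- The CROSSED rule meets its specification at every lawful letter configuration, in both bases
(finite check over `Bool × Fin 3⁶`). -/
theorem crκ_spec_bool : ∀ (q : Bool) (x₁ x₂ yb yc zb zc : Fin 3), lawκ q x₁ x₂ yb yc zb zc = true →
    crGoodAt q x₁ x₂ yb yc zb zc (crκ q x₁ x₂ yb yc zb zc) = true := by
  decide

/-- THE CROSSED LOCAL LEMMA IN BOTH BASES (Prop form, through the letter projections). -/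
theorem crκ_spec (q : Bool) (x₁ x₂ yb yc zb zc : Fin 3) (h : lawκ q x₁ x₂ yb yc zb zc = true) :
    slotB q (crκA₁ q x₁ x₂ yb yc zb zc) (crκB₁ q x₁ x₂ yb yc zb zc) (crκC₁ q x₁ x₂ yb yc zb zc)
        = true ∧
    slotB q (crκA₂ q x₁ x₂ yb yc zb zc) (crκB₂ q x₁ x₂ yb yc zb zc) (crκC₂ q x₁ x₂ yb yc zb zc)
        = true ∧
    (crκA₂ q x₁ x₂ yb yc zb zc ≠ yc ∧ yc ≠ crκC₁ q x₁ x₂ yb yc zb zc ∧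
      crκA₂ q x₁ x₂ yb yc zb zc ≠ crκC₁ q x₁ x₂ yb yc zb zc) ∧
    (crκA₁ q x₁ x₂ yb yc zb zc ≠ crκB₂ q x₁ x₂ yb yc zb zc ∧ crκB₂ q x₁ x₂ yb yc zb zc ≠ zb ∧
      crκA₁ q x₁ x₂ yb yc zb zc ≠ zb) ∧
    lawκ q x₁ x₂ yb (crκB₁ q x₁ x₂ yb yc zb zc) zc (crκC₂ q x₁ x₂ yb yc zb zc) = true ∧
    (q = false → crκB₁ q x₁ x₂ yb yc zb zc ≠ yb ∧ crκC₂ q x₁ x₂ yb yc zb zc ≠ zc) := by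
  have h' := crκ_spec_bool q x₁ x₂ yb yc zb zc h
  rwa [crGoodAt, decide_eq_true_iff] at h'

/-! ## §4 The SPREAD rule in both bases -/

/-- SPREAD candidate rows at a cw tail coordinate (6 triples of cw rows). [new] -/
def spCwList : List ((Fin 3 × Fin 3 × Fin 3) × (Fin 3 × Fin 3 × Fin 3) × (Fin 3 × Fin 3 × Fin 3)) :=
  [((0, 1, 1), (0, 1, 1), (0, 2, 2)),
   ((0, 1, 1), (0, 2, 2), (0, 1, 1)),
   ((0, 1, 1), (0, 1, 1), (2, 2, 0)),
   ((0, 1, 1), (1, 0, 1), (0, 2, 2)),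
   ((0, 2, 2), (0, 1, 1), (2, 2, 0)),
   ((0, 2, 2), (1, 0, 1), (0, 2, 2))]

/-- The SPREAD local constraints ON A CANDIDATE triple of auxiliary rows
`((A₁,B₁,C₁),(A₂,B₂,C₂),(A₃,B₃,C₃))` at a tail coordinate with basis flag `q` and (oriented)
missing letters `x_η x_ζ | y_ξ y_ζ | z_ξ z_η`: rows in the slot pattern, the star slot
`(A₁, B₃, C₂)` letter-distinct, the co-size-2 slots `(x_η A₂ | y_ζ B₁ | z_ξ C₃)`,
`(x_ζ A₃ | y_ξ B₂ | z_η C₁)` lawful, and — at a permutation coordinate only — the six flags.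
[new] -/
def spGoodAt (q : Bool) (xe xz yx yz zx ze : Fin 3)
    (c : (Fin 3 × Fin 3 × Fin 3) × (Fin 3 × Fin 3 × Fin 3) × (Fin 3 × Fin 3 × Fin 3)) : Bool :=
  decide (slotB q c.1.1 c.1.2.1 c.1.2.2 = true ∧ slotB q c.2.1.1 c.2.1.2.1 c.2.1.2.2 = true ∧
    slotB q c.2.2.1 c.2.2.2.1 c.2.2.2.2 = true ∧
    (c.1.1 ≠ c.2.2.2.1 ∧ c.2.2.2.1 ≠ c.2.1.2.2 ∧ c.1.1 ≠ c.2.1.2.2) ∧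
    lawκ q xe c.2.1.1 yz c.1.2.1 zx c.2.2.2.2 = true ∧
    lawκ q xz c.2.2.1 yx c.2.1.2.1 ze c.1.2.2 = true ∧
    (q = false → c.2.1.1 ≠ xe ∧ c.2.2.1 ≠ xz ∧ c.1.2.1 ≠ yz ∧ c.2.1.2.1 ≠ yx ∧ c.2.2.2.2 ≠ zx ∧
      c.1.2.2 ≠ ze))

/-- THE SPREAD RULE IN BOTH BASES: `spRule r` of `…PowSubTwoSpread` at a permutation coordinate
(selector `r`), the first fitting entry of `spCwList` at a cw coordinate (selector ignored).
[new] -/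
def spκ (q r : Bool) (xe xz yx yz zx ze : Fin 3) :
    (Fin 3 × Fin 3 × Fin 3) × (Fin 3 × Fin 3 × Fin 3) × (Fin 3 × Fin 3 × Fin 3) :=
  if q then pick spCwList (spGoodAt true xe xz yx yz zx ze) ((0, 1, 1), (0, 1, 1), (0, 1, 1))
  else spRule r xe xz yx yz zx ze

/-- At a permutation coordinate the rule is `spRule` (definitionally; so `sp_diff` applies). -/
theorem spκ_false (r : Bool) (xe xz yx yz zx ze : Fin 3) :
    spκ false r xe xz yx yz zx ze = spRule r xe xz yx yz zx ze := rfl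

/-- [new] -/ def spκA₁ (q r : Bool) (xe xz yx yz zx ze : Fin 3) : Fin 3 :=
  (spκ q r xe xz yx yz zx ze).1.1
/-- [new] -/ def spκB₁ (q r : Bool) (xe xz yx yz zx ze : Fin 3) : Fin 3 :=
  (spκ q r xe xz yx yz zx ze).1.2.1
/-- [new] -/ def spκC₁ (q r : Bool) (xe xz yx yz zx ze : Fin 3) : Fin 3 :=
  (spκ q r xe xz yx yz zx ze).1.2.2
/-- [new] -/ def spκA₂ (q r : Bool) (xe xz yx yz zx ze : Fin 3) : Fin 3 :=
  (spκ q r xe xz yx yz zx ze).2.1.1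
/-- [new] -/ def spκB₂ (q r : Bool) (xe xz yx yz zx ze : Fin 3) : Fin 3 :=
  (spκ q r xe xz yx yz zx ze).2.1.2.1
/-- [new] -/ def spκC₂ (q r : Bool) (xe xz yx yz zx ze : Fin 3) : Fin 3 :=
  (spκ q r xe xz yx yz zx ze).2.1.2.2
/-- [new] -/ def spκA₃ (q r : Bool) (xe xz yx yz zx ze : Fin 3) : Fin 3 :=
  (spκ q r xe xz yx yz zx ze).2.2.1
/-- [new] -/ def spκB₃ (q r : Bool) (xe xz yx yz zx ze : Fin 3) : Fin 3 :=
  (spκ q r xe xz yx yz zx ze).2.2.2.1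
/-- [new] -/ def spκC₃ (q r : Bool) (xe xz yx yz zx ze : Fin 3) : Fin 3 :=
  (spκ q r xe xz yx yz zx ze).2.2.2.2

/-- The letter projections at a permutation coordinate are those of `…PowSubTwoSpread`. -/
theorem spκ_false_proj (r : Bool) (xe xz yx yz zx ze : Fin 3) :
    spκA₁ false r xe xz yx yz zx ze = spA₁ r xe xz yx yz zx ze ∧
    spκB₁ false r xe xz yx yz zx ze = spB₁ r xe xz yx yz zx ze ∧
    spκC₁ false r xe xz yx yz zx ze = spC₁ r xe xz yx yz zx ze ∧
    spκA₂ false r xe xz yx yz zx ze = spA₂ r xe xz yx yz zx ze ∧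
    spκB₂ false r xe xz yx yz zx ze = spB₂ r xe xz yx yz zx ze ∧
    spκC₂ false r xe xz yx yz zx ze = spC₂ r xe xz yx yz zx ze ∧
    spκA₃ false r xe xz yx yz zx ze = spA₃ r xe xz yx yz zx ze ∧
    spκB₃ false r xe xz yx yz zx ze = spB₃ r xe xz yx yz zx ze ∧
    spκC₃ false r xe xz yx yz zx ze = spC₃ r xe xz yx yz zx ze :=
  ⟨rfl, rfl, rfl, rfl, rfl, rfl, rfl, rfl, rfl⟩

/-- The SPREAD rule meets its specification at every lawful configuration, in both bases; at a
permutation coordinate the three pairs must not be doubled (the SPREAD pivot rule guarantees it). -/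
theorem spκ_spec_bool : ∀ (q r : Bool) (xe xz yx yz zx ze : Fin 3),
    lawκ q xe xz yx yz zx ze = true →
    (q = false → xe ≠ xz ∧ yx ≠ yz ∧ zx ≠ ze) →
    spGoodAt q xe xz yx yz zx ze (spκ q r xe xz yx yz zx ze) = true := by
  decide

/-- THE SPREAD LOCAL LEMMA IN BOTH BASES (Prop form). -/
theorem spκ_spec (q r : Bool) (xe xz yx yz zx ze : Fin 3) (h : lawκ q xe xz yx yz zx ze = true)
    (hsp : q = false → xe ≠ xz ∧ yx ≠ yz ∧ zx ≠ ze) :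
    slotB q (spκA₁ q r xe xz yx yz zx ze) (spκB₁ q r xe xz yx yz zx ze)
        (spκC₁ q r xe xz yx yz zx ze) = true ∧
    slotB q (spκA₂ q r xe xz yx yz zx ze) (spκB₂ q r xe xz yx yz zx ze)
        (spκC₂ q r xe xz yx yz zx ze) = true ∧
    slotB q (spκA₃ q r xe xz yx yz zx ze) (spκB₃ q r xe xz yx yz zx ze)
        (spκC₃ q r xe xz yx yz zx ze) = true ∧
    (spκA₁ q r xe xz yx yz zx ze ≠ spκB₃ q r xe xz yx yz zx ze ∧
      spκB₃ q r xe xz yx yz zx ze ≠ spκC₂ q r xe xz yx yz zx ze ∧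
      spκA₁ q r xe xz yx yz zx ze ≠ spκC₂ q r xe xz yx yz zx ze) ∧
    lawκ q xe (spκA₂ q r xe xz yx yz zx ze) yz (spκB₁ q r xe xz yx yz zx ze) zx
      (spκC₃ q r xe xz yx yz zx ze) = true ∧
    lawκ q xz (spκA₃ q r xe xz yx yz zx ze) yx (spκB₂ q r xe xz yx yz zx ze) ze
      (spκC₁ q r xe xz yx yz zx ze) = true ∧
    (q = false → spκA₂ q r xe xz yx yz zx ze ≠ xe ∧ spκA₃ q r xe xz yx yz zx ze ≠ xz ∧
      spκB₁ q r xe xz yx yz zx ze ≠ yz ∧ spκB₂ q r xe xz yx yz zx ze ≠ yx ∧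
      spκC₃ q r xe xz yx yz zx ze ≠ zx ∧ spκC₁ q r xe xz yx yz zx ze ≠ ze) := by
  have h' := spκ_spec_bool q r xe xz yx yz zx ze h hsp
  rwa [spGoodAt, decide_eq_true_iff] at h'

end Summit.MatrixMultiplication.MatrixMultiplication.Theorems.OutsiderSandwichToricCeilingPowMixedRules
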